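import Summits.HubbardSuperconductivity.HubbardLadder.EDSectorGlue
import Summits.HubbardSuperconductivity.HubbardLadder.EDCornerBound
import Literature.Analysis.OperatorTheory.PencilBlockCertificate
import HarnessLib

/-!
# EDBlockGlue — one symmetry block of the E-D-2″ certificate: from ONE exact PSD fact to the `blk` field

HONEST FRAMING (page 1): ladder R1–R4 with certified numbers; no claim on H/H₀. This file closes the
Lean side of the E-D-2″ design (`pub-hubbard-r3/R4-MEMO.md` §7.3): for ONE symmetry block `b` of a
block-ordered real orbit-sum frame `Φ` of the `t–t'` Hubbard torus `H = hubbardTorusTT' L 1 t' U`, the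
per-block certified inequality required by `EDSectorBlockCert.blk`
  `β · wᵀ G_b w ≤ wᵀ M_b w` on `{c_{j,b} ⬝ w = 0}`
follows from
* a SUPPORT CHECK on the free columns of the block (every free column is supported on configurations
  with at least `d₀` doubly occupied sites) — whence the corner constant `ρ₀ = U d₀ − 4 S_L(t')` of
  `EDCornerBoundTT'` bounds the free corner of the pencil from below (`frame_form_ge_of_support_bound`);
* `β < ρ₀`, weights `t ≥ 0`, a Gershgorin-type bound `M_F − β G_F ⪯ cmax₀ G_F`;
* ONE positive-semidefiniteness fact (Chebyshev shape or residual shape,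
  `Literature.Analysis.OperatorTheory.form_ge_of_pencil_chebyshev_block_cert` / `…_residual_block_cert`).
All three are finite statements about explicit rational matrices, checked by the campaign's exact
verifier; no certificate exists today and nothing here is numerical evidence.
-/

noncomputable section

namespace Summit.HubbardSuperconductivity.HubbardLadder

open Matrix Literature.MathematicalPhysics.QuantumLattice
  Literature.MathematicalPhysics.QuantumLattice.TempleKato Literature.Analysis.OperatorTheory
  Summit.HubbardSuperconductivity.HubbardLadder.Bounds
open scoped ComplexOrder

section Corners

variable {B : Type} {F P : B → Type}
  (M G : Matrix ((b : B) × (F b ⊕ P b)) ((b : B) × (F b ⊕ P b)) ℝ) (b : B)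

/-- Free corner `M_F` of block `b`. [folklore] -/
def freeCorner : Matrix (F b) (F b) ℝ := Matrix.of fun i i' => M ⟨b, Sum.inl i⟩ ⟨b, Sum.inl i'⟩
/-- Coupling corner `M_FP` of block `b`. [folklore] -/
def couplingCorner : Matrix (F b) (P b) ℝ := Matrix.of fun i i' => M ⟨b, Sum.inl i⟩ ⟨b, Sum.inr i'⟩
/-- Pinned corner `M_P` of block `b`. [folklore] -/
def pinnedCorner : Matrix (P b) (P b) ℝ := Matrix.of fun i i' => M ⟨b, Sum.inr i⟩ ⟨b, Sum.inr i'⟩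
/-- Free Gram weights `g_F` (orbit sizes) of block `b`. [folklore] -/
def freeWeight : F b → ℝ := fun i => G ⟨b, Sum.inl i⟩ ⟨b, Sum.inl i⟩
/-- Pinned Gram weights `g_P` of block `b`. [folklore] -/
def pinnedWeight : P b → ℝ := fun i => G ⟨b, Sum.inr i⟩ ⟨b, Sum.inr i⟩

/-- The `b`-corner of a symmetric `M` is the block matrix of its corners. [folklore] -/
theorem blockCorner_eq_fromBlocks (hM : M.IsHermitian) :
    (Matrix.of fun i i' => M ⟨b, i⟩ ⟨b, i'⟩) =
      fromBlocks (freeCorner M b) (couplingCorner M b) (couplingCorner M b)ᵀ (pinnedCorner M b) := by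
  ext (i | i) (i' | i')
  · rfl
  · rfl
  · change M _ _ = M _ _
    have h := hM.apply ⟨b, Sum.inl i'⟩ ⟨b, Sum.inr i⟩
    rw [star_trivial] at h
    exact h
  · rfl

/-- The `b`-corner of a DIAGONAL Gram matrix is `fromBlocks (diagonal g_F) 0 0 (diagonal g_P)`. [folklore] -/
theorem gramCorner_eq_fromBlocks [∀ b, DecidableEq (F b)] [∀ b, DecidableEq (P b)]
    (hGoff : ∀ a a', a ≠ a' → G a a' = 0) :
    (Matrix.of fun i i' => G ⟨b, i⟩ ⟨b, i'⟩) =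
      fromBlocks (diagonal (freeWeight G b)) 0 0 (diagonal (pinnedWeight G b)) := by
  ext (i | i) (i' | i')
  · change G _ _ = diagonal _ i i'
    by_cases h : i = i'
    · subst h; simp [freeWeight]
    · rw [diagonal_apply_ne _ h]
      exact hGoff _ _ fun e => h (Sum.inl_injective (eq_of_heq (Sigma.mk.inj_iff.mp e).2))
  · change G _ _ = 0
    exact hGoff _ _ fun e => Sum.inl_ne_inr (eq_of_heq (Sigma.mk.inj_iff.mp e).2)
  · change G _ _ = 0
    exact hGoff _ _ fun e => Sum.inr_ne_inl (eq_of_heq (Sigma.mk.inj_iff.mp e).2)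
  · change G _ _ = diagonal _ i i'
    by_cases h : i = i'
    · subst h; simp [pinnedWeight]
    · rw [diagonal_apply_ne _ h]
      exact hGoff _ _ fun e => h (Sum.inr_injective (eq_of_heq (Sigma.mk.inj_iff.mp e).2))

end Corners

section FreeCornerBound

variable {ι : Type} [Fintype ι] {B : Type} {F P : B → Type}

/-- Compression restricted to the free columns of block `b`. [folklore] -/
theorem freeFrame_compression (A : Matrix ι ι ℂ) (Φ : Matrix ι ((b : B) × (F b ⊕ P b)) ℂ)
    (M : Matrix ((b : B) × (F b ⊕ P b)) ((b : B) × (F b ⊕ P b)) ℝ)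
    (hM : Φᴴ * A * Φ = M.map ((↑) : ℝ → ℂ)) (b : B) :
    (Φ.submatrix id (fun i : F b => (⟨b, Sum.inl i⟩ : (b : B) × (F b ⊕ P b))))ᴴ * A *
        Φ.submatrix id (fun i : F b => (⟨b, Sum.inl i⟩ : (b : B) × (F b ⊕ P b))) =
      (freeCorner M b).map ((↑) : ℝ → ℂ) := by
  ext i i'
  have h := congrFun (congrFun hM ⟨b, Sum.inl i⟩) ⟨b, Sum.inl i'⟩
  simp only [map_apply] at h ⊢
  rw [freeCorner, of_apply, ← h]
  simp only [mul_apply, conjTranspose_apply, submatrix_apply, id]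

/-- Gram matrix restricted to the free columns of block `b` (diagonal frame). [folklore] -/
theorem freeFrame_gram [∀ b, DecidableEq (F b)] (Φ : Matrix ι ((b : B) × (F b ⊕ P b)) ℂ)
    (G : Matrix ((b : B) × (F b ⊕ P b)) ((b : B) × (F b ⊕ P b)) ℝ)
    (hG : Φᴴ * Φ = G.map ((↑) : ℝ → ℂ)) (hGoff : ∀ a a', a ≠ a' → G a a' = 0) (b : B) :
    (Φ.submatrix id (fun i : F b => (⟨b, Sum.inl i⟩ : (b : B) × (F b ⊕ P b))))ᴴ *
        Φ.submatrix id (fun i : F b => (⟨b, Sum.inl i⟩ : (b : B) × (F b ⊕ P b))) =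
      (diagonal (freeWeight G b)).map ((↑) : ℝ → ℂ) := by
  ext i i'
  have h := congrFun (congrFun hG ⟨b, Sum.inl i⟩) ⟨b, Sum.inl i'⟩
  simp only [map_apply] at h ⊢
  have e : ((Φ.submatrix id (fun i : F b => (⟨b, Sum.inl i⟩ : (b : B) × (F b ⊕ P b))))ᴴ *
      Φ.submatrix id (fun i : F b => (⟨b, Sum.inl i⟩ : (b : B) × (F b ⊕ P b)))) i i' =
      (Φᴴ * Φ) ⟨b, Sum.inl i⟩ ⟨b, Sum.inl i'⟩ := by
    simp only [mul_apply, conjTranspose_apply, submatrix_apply, id]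
  rw [e, h]
  by_cases hii : i = i'
  · subst hii; simp [freeWeight]
  · rw [diagonal_apply_ne _ hii,
      hGoff _ _ fun e => hii (Sum.inl_injective (eq_of_heq (Sigma.mk.inj_iff.mp e).2))]

/-- **Free-corner pencil bound from a Fock-space support bound.** If every free column of block `b`
is supported where `S` holds and `ρ₀ ‖ψ‖² ≤ Re⟨ψ, A ψ⟩` for every `ψ` supported there, then
`ρ₀ · xᵀ diag(g_F) x ≤ xᵀ M_F x`. [folklore] -/
theorem freeCorner_form_ge [∀ b, Fintype (F b)] [∀ b, DecidableEq (F b)] (A : Matrix ι ι ℂ) (S : ι → Prop) (ρ₀ : ℝ)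
    (hcorner : ∀ ψ : ι → ℂ, (∀ s, ¬ S s → ψ s = 0) → ρ₀ * (star ψ ⬝ᵥ ψ).re ≤ (star ψ ⬝ᵥ A *ᵥ ψ).re)
    (Φ : Matrix ι ((b : B) × (F b ⊕ P b)) ℂ)
    (M G : Matrix ((b : B) × (F b ⊕ P b)) ((b : B) × (F b ⊕ P b)) ℝ)
    (hM : Φᴴ * A * Φ = M.map ((↑) : ℝ → ℂ)) (hG : Φᴴ * Φ = G.map ((↑) : ℝ → ℂ))
    (hGoff : ∀ a a', a ≠ a' → G a a' = 0) (b : B) (hsupp : ∀ s (i : F b), ¬ S s → Φ s ⟨b, Sum.inl i⟩ = 0)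
    (x : F b → ℝ) :
    ρ₀ * (x ⬝ᵥ (diagonal (freeWeight G b) *ᵥ x)) ≤ x ⬝ᵥ (freeCorner M b *ᵥ x) :=
  frame_form_ge_of_support_bound A S ρ₀ hcorner
    (Φ.submatrix id (fun i : F b => (⟨b, Sum.inl i⟩ : (b : B) × (F b ⊕ P b))))
    (fun s i hs => hsupp s i hs) (freeCorner M b) (diagonal (freeWeight G b))
    (freeFrame_compression A Φ M hM b) (freeFrame_gram Φ G hG hGoff b) x

end FreeCornerBound

section Block

variable {L : ℕ} [NeZero L] {B : Type} {F P : B → Type} [∀ b, Fintype (F b)]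
  [∀ b, Fintype (P b)] [∀ b, DecidableEq (F b)] [∀ b, DecidableEq (P b)]

/-- **The `blk b` field of `EDSectorBlockCert` from ONE exact PSD fact (Chebyshev shape).**
Frame data: `Φᴴ H Φ = M`, `Φᴴ Φ = G` real with `G` DIAGONAL and positive (orthogonal orbit sums),
`H = hubbardTorusTT' L 1 t' U` (`L ≥ 3`, `U ≥ 0`); block `b` whose free columns are supported on
configurations with `≥ d₀` double occupancies; `ρ₀ = U d₀ − 4 S_L(t')`, `β < ρ₀`; constraint vectors
`c_j`; weights `t ≥ 0`; Gershgorin bound `cmax₀`; Chebyshev degree `N ≠ 0`; and the PSD fact `hcert`.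
[folklore] -/
theorem blk_of_pencil_chebyshev_cert (hL : 3 ≤ L) (t' U : ℝ) (hU : 0 ≤ U) (d₀ : ℕ) (β : ℝ)
    (Φ : Matrix (Finset (Orb (FermionTorus 2 L))) ((b : B) × (F b ⊕ P b)) ℂ)
    (M G : Matrix ((b : B) × (F b ⊕ P b)) ((b : B) × (F b ⊕ P b)) ℝ)
    (hM : Φᴴ * hubbardTorusTT' L 1 t' U * Φ = M.map ((↑) : ℝ → ℂ))
    (hG : Φᴴ * Φ = G.map ((↑) : ℝ → ℂ)) (hGoff : ∀ a a', a ≠ a' → G a a' = 0)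
    (hGpos : ∀ a, 0 < G a a) (b : B)
    (hsupp : ∀ s (i : F b), (doublyOccupied s).card < d₀ → Φ s ⟨b, Sum.inl i⟩ = 0)
    (hβ : β < -(4 * cornerBathtubSum L t') + U * d₀)
    {m : ℕ} (c : Fin m → ((b : B) × (F b ⊕ P b)) → ℝ) (t : Fin m → ℝ) (ht : ∀ j, 0 ≤ t j)
    (cmax₀ : ℝ)
    (hGersh : (cmax₀ • diagonal (freeWeight G b) -
      (freeCorner M b - β • diagonal (freeWeight G b))).PosSemidef)
    {N : ℕ} (hN : N ≠ 0)
    (hcm : -(4 * cornerBathtubSum L t') + U * d₀ - β <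
      cmax₀ + ∑ j, t j * ∑ a, (c j ⟨b, Sum.inl a⟩) ^ 2 / freeWeight G b a)
    (hcert : (primedPinned (pinnedCorner M b) (pinnedWeight G b) β t (fun j i => c j ⟨b, Sum.inr i⟩) -
      (primedCoupling (couplingCorner M b) t (fun j i => c j ⟨b, Sum.inl i⟩)
          (fun j i => c j ⟨b, Sum.inr i⟩))ᵀ *
        (Polynomial.aeval (diagonal (fun i => (freeWeight G b i)⁻¹) *
            primedFree (freeCorner M b) (freeWeight G b) β t (fun j i => c j ⟨b, Sum.inl i⟩))
          (Literature.Analysis.ValidatedNumerics.chebInvPoly (-(4 * cornerBathtubSum L t') + U * d₀ - β)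
            (cmax₀ + ∑ j, t j * ∑ a, (c j ⟨b, Sum.inl a⟩) ^ 2 / freeWeight G b a) N) *
          diagonal (fun i => (freeWeight G b i)⁻¹)) *
        primedCoupling (couplingCorner M b) t (fun j i => c j ⟨b, Sum.inl i⟩)
          (fun j i => c j ⟨b, Sum.inr i⟩)).PosSemidef) :
    ∀ (x : F b → ℝ) (y : P b → ℝ), (∀ j, (fun i => c j ⟨b, i⟩) ⬝ᵥ Sum.elim x y = 0) →
      β * (Sum.elim x y ⬝ᵥ (Matrix.of fun i i' => G ⟨b, i⟩ ⟨b, i'⟩) *ᵥ Sum.elim x y) ≤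
        Sum.elim x y ⬝ᵥ (Matrix.of fun i i' => M ⟨b, i⟩ ⟨b, i'⟩) *ᵥ Sum.elim x y := by
  intro x y hxy
  have hMh : M.IsHermitian :=
    isHermitian_of_real_frame_compression _ (hubbardTorusTT'_isHermitian L 1 t' U) Φ M hM
  have hMF : (freeCorner M b).IsHermitian := by
    ext i i'
    have h := hMh.apply ⟨b, Sum.inl i⟩ ⟨b, Sum.inl i'⟩
    simpa [freeCorner] using h
  have hgF : ∀ a, 0 < freeWeight G b a := fun a => hGpos _
  have hcorner : ∀ x : F b → ℝ, (-(4 * cornerBathtubSum L t') + U * d₀) *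
      (x ⬝ᵥ (diagonal (freeWeight G b) *ᵥ x)) ≤ x ⬝ᵥ (freeCorner M b *ᵥ x) :=
    freeCorner_form_ge (hubbardTorusTT' L 1 t' U) (fun s => d₀ ≤ (doublyOccupied s).card) _
      (fun ψ hψ => edCornerBoundTT'_holds L hL t' U hU d₀ ψ fun s hs => hψ s (not_le.mpr hs))
      Φ M G hM hG hGoff b (fun s i hs => hsupp s i (not_le.mp hs))
  have hz : ∀ j, Sum.elim (fun i => c j ⟨b, Sum.inl i⟩) (fun i => c j ⟨b, Sum.inr i⟩) ⬝ᵥ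
      Sum.elim x y = 0 := fun j => by
    have e : Sum.elim (fun i => c j ⟨b, Sum.inl i⟩) (fun i => c j ⟨b, Sum.inr i⟩) =
        fun i => c j ⟨b, i⟩ := funext fun i => by cases i <;> rfl
    rw [e]; exact hxy j
  rw [blockCorner_eq_fromBlocks M b hMh, gramCorner_eq_fromBlocks G b hGoff]
  exact form_ge_of_pencil_chebyshev_block_cert (freeCorner M b) (couplingCorner M b) (pinnedCorner M b)
    (freeWeight G b) (pinnedWeight G b) β _ t _ _ hMF hgF hβ ht hcorner cmax₀ hGersh hN hcm hcert
    (Sum.elim x y) hz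

/-- **The `blk b` field from ONE exact PSD fact (residual / approximate-inverse shape).** Same frame
data; any matrix `Y` (float `A'⁻¹B'` rounded); no Gershgorin bound and no polynomial. [folklore] -/
theorem blk_of_residual_cert (hL : 3 ≤ L) (t' U : ℝ) (hU : 0 ≤ U) (d₀ : ℕ) (β : ℝ)
    (Φ : Matrix (Finset (Orb (FermionTorus 2 L))) ((b : B) × (F b ⊕ P b)) ℂ)
    (M G : Matrix ((b : B) × (F b ⊕ P b)) ((b : B) × (F b ⊕ P b)) ℝ)
    (hM : Φᴴ * hubbardTorusTT' L 1 t' U * Φ = M.map ((↑) : ℝ → ℂ))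
    (hG : Φᴴ * Φ = G.map ((↑) : ℝ → ℂ)) (hGoff : ∀ a a', a ≠ a' → G a a' = 0)
    (hGpos : ∀ a, 0 < G a a) (b : B)
    (hsupp : ∀ s (i : F b), (doublyOccupied s).card < d₀ → Φ s ⟨b, Sum.inl i⟩ = 0)
    (hβ : β < -(4 * cornerBathtubSum L t') + U * d₀)
    {m : ℕ} (c : Fin m → ((b : B) × (F b ⊕ P b)) → ℝ) (t : Fin m → ℝ) (ht : ∀ j, 0 ≤ t j)
    (Y : Matrix (F b) (P b) ℝ)
    (hcert : (primedPinned (pinnedCorner M b) (pinnedWeight G b) β t (fun j i => c j ⟨b, Sum.inr i⟩) +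
        Yᵀ * primedFree (freeCorner M b) (freeWeight G b) β t (fun j i => c j ⟨b, Sum.inl i⟩) * Y -
        Yᵀ * primedCoupling (couplingCorner M b) t (fun j i => c j ⟨b, Sum.inl i⟩)
          (fun j i => c j ⟨b, Sum.inr i⟩) -
        (primedCoupling (couplingCorner M b) t (fun j i => c j ⟨b, Sum.inl i⟩)
          (fun j i => c j ⟨b, Sum.inr i⟩))ᵀ * Y -
        (-(4 * cornerBathtubSum L t') + U * d₀ - β)⁻¹ •
          ((primedCoupling (couplingCorner M b) t (fun j i => c j ⟨b, Sum.inl i⟩)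
              (fun j i => c j ⟨b, Sum.inr i⟩) -
            primedFree (freeCorner M b) (freeWeight G b) β t (fun j i => c j ⟨b, Sum.inl i⟩) * Y)ᵀ *
          diagonal (fun i => (freeWeight G b i)⁻¹) *
          (primedCoupling (couplingCorner M b) t (fun j i => c j ⟨b, Sum.inl i⟩)
              (fun j i => c j ⟨b, Sum.inr i⟩) -
            primedFree (freeCorner M b) (freeWeight G b) β t (fun j i => c j ⟨b, Sum.inl i⟩) * Y))
      ).PosSemidef) :
    ∀ (x : F b → ℝ) (y : P b → ℝ), (∀ j, (fun i => c j ⟨b, i⟩) ⬝ᵥ Sum.elim x y = 0) →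
      β * (Sum.elim x y ⬝ᵥ (Matrix.of fun i i' => G ⟨b, i⟩ ⟨b, i'⟩) *ᵥ Sum.elim x y) ≤
        Sum.elim x y ⬝ᵥ (Matrix.of fun i i' => M ⟨b, i⟩ ⟨b, i'⟩) *ᵥ Sum.elim x y := by
  intro x y hxy
  have hMh : M.IsHermitian :=
    isHermitian_of_real_frame_compression _ (hubbardTorusTT'_isHermitian L 1 t' U) Φ M hM
  have hMF : (freeCorner M b).IsHermitian := by
    ext i i'
    have h := hMh.apply ⟨b, Sum.inl i⟩ ⟨b, Sum.inl i'⟩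
    simpa [freeCorner] using h
  have hgF : ∀ a, 0 < freeWeight G b a := fun a => hGpos _
  have hcorner : ∀ x : F b → ℝ, (-(4 * cornerBathtubSum L t') + U * d₀) *
      (x ⬝ᵥ (diagonal (freeWeight G b) *ᵥ x)) ≤ x ⬝ᵥ (freeCorner M b *ᵥ x) :=
    freeCorner_form_ge (hubbardTorusTT' L 1 t' U) (fun s => d₀ ≤ (doublyOccupied s).card) _
      (fun ψ hψ => edCornerBoundTT'_holds L hL t' U hU d₀ ψ fun s hs => hψ s (not_le.mpr hs))
      Φ M G hM hG hGoff b (fun s i hs => hsupp s i (not_le.mp hs))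
  have hz : ∀ j, Sum.elim (fun i => c j ⟨b, Sum.inl i⟩) (fun i => c j ⟨b, Sum.inr i⟩) ⬝ᵥ
      Sum.elim x y = 0 := fun j => by
    have e : Sum.elim (fun i => c j ⟨b, Sum.inl i⟩) (fun i => c j ⟨b, Sum.inr i⟩) =
        fun i => c j ⟨b, i⟩ := funext fun i => by cases i <;> rfl
    rw [e]; exact hxy j
  rw [blockCorner_eq_fromBlocks M b hMh, gramCorner_eq_fromBlocks G b hGoff]
  exact form_ge_of_residual_block_cert (freeCorner M b) (couplingCorner M b) (pinnedCorner M b)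
    (freeWeight G b) (pinnedWeight G b) β _ t _ _ hMF hgF hβ ht hcorner Y hcert (Sum.elim x y) hz

end Block

/-- **Typed obligation T7.3-block, Chebyshev shape** — `blk_of_pencil_chebyshev_cert` holds (PROVED:
`edBlockGlueChebyshev_holds`). -/
@[conjecture] def EDBlockGlueChebyshev : Prop :=
  ∀ (L : ℕ) [NeZero L], 3 ≤ L → ∀ (t' U : ℝ), 0 ≤ U → ∀ (d₀ : ℕ) (β : ℝ)
    (B : Type) (F P : B → Type) [∀ b, Fintype (F b)] [∀ b, Fintype (P b)]
    [∀ b, DecidableEq (F b)] [∀ b, DecidableEq (P b)]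
    (Φ : Matrix (Finset (Orb (FermionTorus 2 L))) ((b : B) × (F b ⊕ P b)) ℂ)
    (M G : Matrix ((b : B) × (F b ⊕ P b)) ((b : B) × (F b ⊕ P b)) ℝ),
    Φᴴ * hubbardTorusTT' L 1 t' U * Φ = M.map ((↑) : ℝ → ℂ) → Φᴴ * Φ = G.map ((↑) : ℝ → ℂ) →
    (∀ a a', a ≠ a' → G a a' = 0) → (∀ a, 0 < G a a) →
    ∀ (b : B), (∀ s (i : F b), (doublyOccupied s).card < d₀ → Φ s ⟨b, Sum.inl i⟩ = 0) →
    β < -(4 * cornerBathtubSum L t') + U * d₀ →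
    ∀ (m : ℕ) (c : Fin m → ((b : B) × (F b ⊕ P b)) → ℝ) (t : Fin m → ℝ), (∀ j, 0 ≤ t j) →
    ∀ (cmax₀ : ℝ), (cmax₀ • diagonal (freeWeight G b) -
      (freeCorner M b - β • diagonal (freeWeight G b))).PosSemidef →
    ∀ (N : ℕ), N ≠ 0 →
    -(4 * cornerBathtubSum L t') + U * d₀ - β <
      cmax₀ + ∑ j, t j * ∑ a, (c j ⟨b, Sum.inl a⟩) ^ 2 / freeWeight G b a →
    (primedPinned (pinnedCorner M b) (pinnedWeight G b) β t (fun j i => c j ⟨b, Sum.inr i⟩) -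
      (primedCoupling (couplingCorner M b) t (fun j i => c j ⟨b, Sum.inl i⟩)
          (fun j i => c j ⟨b, Sum.inr i⟩))ᵀ *
        (Polynomial.aeval (diagonal (fun i => (freeWeight G b i)⁻¹) *
            primedFree (freeCorner M b) (freeWeight G b) β t (fun j i => c j ⟨b, Sum.inl i⟩))
          (Literature.Analysis.ValidatedNumerics.chebInvPoly (-(4 * cornerBathtubSum L t') + U * d₀ - β)
            (cmax₀ + ∑ j, t j * ∑ a, (c j ⟨b, Sum.inl a⟩) ^ 2 / freeWeight G b a) N) *
          diagonal (fun i => (freeWeight G b i)⁻¹)) *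
        primedCoupling (couplingCorner M b) t (fun j i => c j ⟨b, Sum.inl i⟩)
          (fun j i => c j ⟨b, Sum.inr i⟩)).PosSemidef →
    ∀ (x : F b → ℝ) (y : P b → ℝ), (∀ j, (fun i => c j ⟨b, i⟩) ⬝ᵥ Sum.elim x y = 0) →
      β * (Sum.elim x y ⬝ᵥ (Matrix.of fun i i' => G ⟨b, i⟩ ⟨b, i'⟩) *ᵥ Sum.elim x y) ≤
        Sum.elim x y ⬝ᵥ (Matrix.of fun i i' => M ⟨b, i⟩ ⟨b, i'⟩) *ᵥ Sum.elim x y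

/-- **Proof of `EDBlockGlueChebyshev`.** -/
theorem edBlockGlueChebyshev_holds : EDBlockGlueChebyshev :=
  fun _ _ hL t' U hU d₀ β _ _ _ _ _ _ _ Φ M G hM hG hGoff hGpos b hsupp hβ _ c t ht cmax₀ hGersh _ hN
      hcm hcert =>
    blk_of_pencil_chebyshev_cert hL t' U hU d₀ β Φ M G hM hG hGoff hGpos b hsupp hβ c t ht cmax₀ hGersh
      hN hcm hcert

/-- **Typed obligation T7.3-block (soundness of one E-D-2″ block certificate)** — the Chebyshev-shape
per-block theorem `blk_of_pencil_chebyshev_cert` and the residual-shape `blk_of_residual_cert` hold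
(PROVED: `edBlockGlue_holds`). Instantiated by the R3 rows at `L = 4`, `U = 8`, `d₀ = 2`
(`ρ₀ = −8` at `t' = 0`, `−10` at `t' = −1/4`, `EDCornerBoundRowsFour`); none exists yet. -/
@[conjecture] def EDBlockGlue : Prop :=
  ∀ (L : ℕ) [NeZero L], 3 ≤ L → ∀ (t' U : ℝ), 0 ≤ U → ∀ (d₀ : ℕ) (β : ℝ)
    (B : Type) (F P : B → Type) [∀ b, Fintype (F b)] [∀ b, Fintype (P b)]
    [∀ b, DecidableEq (F b)] [∀ b, DecidableEq (P b)]
    (Φ : Matrix (Finset (Orb (FermionTorus 2 L))) ((b : B) × (F b ⊕ P b)) ℂ)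
    (M G : Matrix ((b : B) × (F b ⊕ P b)) ((b : B) × (F b ⊕ P b)) ℝ),
    Φᴴ * hubbardTorusTT' L 1 t' U * Φ = M.map ((↑) : ℝ → ℂ) → Φᴴ * Φ = G.map ((↑) : ℝ → ℂ) →
    (∀ a a', a ≠ a' → G a a' = 0) → (∀ a, 0 < G a a) →
    ∀ (b : B), (∀ s (i : F b), (doublyOccupied s).card < d₀ → Φ s ⟨b, Sum.inl i⟩ = 0) →
    β < -(4 * cornerBathtubSum L t') + U * d₀ →
    ∀ (m : ℕ) (c : Fin m → ((b : B) × (F b ⊕ P b)) → ℝ) (t : Fin m → ℝ), (∀ j, 0 ≤ t j) →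
    ∀ (Y : Matrix (F b) (P b) ℝ),
    (primedPinned (pinnedCorner M b) (pinnedWeight G b) β t (fun j i => c j ⟨b, Sum.inr i⟩) +
        Yᵀ * primedFree (freeCorner M b) (freeWeight G b) β t (fun j i => c j ⟨b, Sum.inl i⟩) * Y -
        Yᵀ * primedCoupling (couplingCorner M b) t (fun j i => c j ⟨b, Sum.inl i⟩)
          (fun j i => c j ⟨b, Sum.inr i⟩) -
        (primedCoupling (couplingCorner M b) t (fun j i => c j ⟨b, Sum.inl i⟩)
          (fun j i => c j ⟨b, Sum.inr i⟩))ᵀ * Y -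
        (-(4 * cornerBathtubSum L t') + U * d₀ - β)⁻¹ •
          ((primedCoupling (couplingCorner M b) t (fun j i => c j ⟨b, Sum.inl i⟩)
              (fun j i => c j ⟨b, Sum.inr i⟩) -
            primedFree (freeCorner M b) (freeWeight G b) β t (fun j i => c j ⟨b, Sum.inl i⟩) * Y)ᵀ *
          diagonal (fun i => (freeWeight G b i)⁻¹) *
          (primedCoupling (couplingCorner M b) t (fun j i => c j ⟨b, Sum.inl i⟩)
              (fun j i => c j ⟨b, Sum.inr i⟩) -
            primedFree (freeCorner M b) (freeWeight G b) β t (fun j i => c j ⟨b, Sum.inl i⟩) * Y))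
      ).PosSemidef →
    ∀ (x : F b → ℝ) (y : P b → ℝ), (∀ j, (fun i => c j ⟨b, i⟩) ⬝ᵥ Sum.elim x y = 0) →
      β * (Sum.elim x y ⬝ᵥ (Matrix.of fun i i' => G ⟨b, i⟩ ⟨b, i'⟩) *ᵥ Sum.elim x y) ≤
        Sum.elim x y ⬝ᵥ (Matrix.of fun i i' => M ⟨b, i⟩ ⟨b, i'⟩) *ᵥ Sum.elim x y

/-- **Proof of `EDBlockGlue`** (residual shape; the Chebyshev shape is `blk_of_pencil_chebyshev_cert`). -/
theorem edBlockGlue_holds : EDBlockGlue :=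
  fun _ _ hL t' U hU d₀ β _ _ _ _ _ _ _ Φ M G hM hG hGoff hGpos b hsupp hβ _ c t ht Y hcert =>
    blk_of_residual_cert hL t' U hU d₀ β Φ M G hM hG hGoff hGpos b hsupp hβ c t ht Y hcert

end Summit.HubbardSuperconductivity.HubbardLadder

end
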